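import Mathlib
import Summits.ValiantsHypothesis.ValiantsHypothesis.Theorems.BarrierLeverPartitionMinorsHitByVPHiddenStatesAntipodalWeighted

/-!
# Route BarrierLever — item `PartitionMinorsHitByVP` (stmt-ValiantsHypothesis-19717), line `hidden-states`:
# GENERIC GOODNESS UNDER COORDINATE EMBEDDINGS — sub-cubes on any coordinate set are served by self-dual pieces

Helper file (`--supports stmt-ValiantsHypothesis-19717`; cell valiant-natproofs, rung V4, 𝒟-side door (c), registered line
`Cruxes/PartitionMinorsHitByVP/Lines/hidden_states.lean`, lane `stub_universalJoinWide` / `stub_fit`; prover seat val-np-p6 gen 8).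
No definitions. Closes NO item.

THE POINT. Generic goodness `symDet u e ≠ 0` of a join configuration only sees the coordinates that the rows use: if the rows
`u : Fin r → Finset (Fin n)` are pushed into a bigger coordinate set along an injection `σ : Fin n ↪ Fin h`, the symbolic determinant is
the image of the original one under the (injective) renaming of table indeterminates `X_{(p,o,a)} ↦ X_{(p,o,σ a)}` (`symDet_map_embedding`),
so goodness transfers (`symGood_map_embedding`). Consequence (`symGood_selfDual_subcube`): the antipodal-table theorem
(`symGood_selfDual_cube`, p590814) holds for the full cube on ANY `n` coordinates inside `Fin h` — the form in which sub-cube parts occur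
inside certificates for the line's designs.

WHAT THIS IS NOT: no bearing on universality of any design; item 19717 OPEN; nothing on crux 14610 or VP ≠ VNP.
-/

set_option linter.dupNamespace false

namespace Summit.ValiantsHypothesis.ValiantsHypothesis.Theorems.BarrierLever.HiddenStates

open Finset Matrix MvPolynomial

noncomputable section

namespace SymbJoin

variable {h n m K r : ℕ}

/-- Renaming the coordinate index of the table indeterminates along `σ`. -/
theorem rename_symPoint (σ : Fin n ↪ Fin h) (e : Fin r → Fin m × Finset (Fin K)) (k : Fin r) (a : Fin n) :
    MvPolynomial.rename (fun v : Var m K n => ((v.1, v.2.1, σ v.2.2) : Var m K h)) (symPoint e k a)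
      = symPoint (h := h) e k (σ a) := by
  simp [symPoint, map_add, map_sum, MvPolynomial.rename_X]

/-- **The symbolic determinant under a coordinate embedding** is the renamed symbolic determinant. -/
theorem symDet_map_embedding (σ : Fin n ↪ Fin h) (u : Fin r → Finset (Fin n)) (e : Fin r → Fin m × Finset (Fin K)) :
    symDet (fun i => (u i).map σ) e
      = MvPolynomial.rename (fun v : Var m K n => ((v.1, v.2.1, σ v.2.2) : Var m K h)) (symDet u e) := by
  set f : Var m K n → Var m K h := fun v => (v.1, v.2.1, σ v.2.2) with hf
  rw [symDet, symDet, show (MvPolynomial.rename f) (symMat u e).det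
      = (MvPolynomial.rename f).toRingHom (symMat u e).det from rfl, RingHom.map_det]
  congr 1
  apply Matrix.ext
  intro i k
  rw [RingHom.mapMatrix_apply, Matrix.map_apply]
  change ∏ a ∈ (u i).map σ, symPoint e k a = (MvPolynomial.rename f) (∏ a ∈ u i, symPoint e k a)
  rw [map_prod, Finset.prod_map]
  exact Finset.prod_congr rfl fun a _ => (rename_symPoint σ e k a).symm

/-- **Goodness transfers along coordinate embeddings.** -/
theorem symGood_map_embedding (σ : Fin n ↪ Fin h) (u : Fin r → Finset (Fin n)) (e : Fin r → Fin m × Finset (Fin K))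
    (hG : symDet u e ≠ 0) : symDet (fun i => (u i).map σ) e ≠ 0 := by
  rw [symDet_map_embedding]
  intro h0
  apply hG
  have hinj : Function.Injective (fun v : Var m K n => ((v.1, v.2.1, σ v.2.2) : Var m K h)) := by
    rintro ⟨p, o, a⟩ ⟨p', o', a'⟩ hv
    simp only [Prod.mk.injEq] at hv
    obtain ⟨rfl, rfl, ha⟩ := hv
    rw [σ.injective ha]
  exact (MvPolynomial.rename_injective _ hinj) (by rw [h0, map_zero])

/-- **Self-dual threshold pieces serve sub-cubes on any coordinate set.** Rows = all subsets of the image of `σ : Fin n ↪ Fin h`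
(given as `(u i).map σ` with `u` a bijection onto the subsets of `Fin n`); columns = a self-dual threshold family as in
`symGood_selfDual_cube`. -/
theorem symGood_selfDual_subcube (n τ : ℕ) (w : Fin (n + 1) → ℕ) (hW : ∑ q, w q = 2 * τ + 1) (σ : Fin n ↪ Fin h)
    (u : Fin r → Finset (Fin n)) (hu : Function.Bijective u)
    (e : Fin r → Fin m × Finset (Fin K)) (ι : Fin (n + 1) ↪ Fin K) (J : Fin r → Finset (Fin (n + 1)))
    (hJ : Function.Injective J) (hwt : ∀ k, ∑ q ∈ J k, w q ≤ τ) (he : ∀ k, (e k).2 = (J k).map ι) :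
    symDet (fun i => (u i).map σ) e ≠ 0 :=
  symGood_map_embedding σ u e (symGood_selfDual_cube n τ w hW u hu e ι J hJ hwt he)

/-- Numeric form of `symGood_selfDual_subcube`. -/
theorem exists_table_selfDual_subcube (n τ : ℕ) (w : Fin (n + 1) → ℕ) (hW : ∑ q, w q = 2 * τ + 1) (σ : Fin n ↪ Fin h)
    (u : Fin r → Finset (Fin n)) (hu : Function.Bijective u)
    (e : Fin r → Fin m × Finset (Fin K)) (ι : Fin (n + 1) ↪ Fin K) (J : Fin r → Finset (Fin (n + 1)))
    (hJ : Function.Injective J) (hwt : ∀ k, ∑ q ∈ J k, w q ≤ τ) (he : ∀ k, (e k).2 = (J k).map ι) :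
    ∃ tx : Fin m → Option (Fin K) → Fin h → ℂ,
      (Matrix.of fun i k : Fin r =>
        ∏ a ∈ (u i).map σ, (tx (e k).1 none a + ∑ q ∈ (e k).2, tx (e k).1 (some q) a)).det ≠ 0 :=
  exists_table_of_symGood (fun i => (u i).map σ) e (symGood_selfDual_subcube n τ w hW σ u hu e ι J hJ hwt he)

end SymbJoin

end

end Summit.ValiantsHypothesis.ValiantsHypothesis.Theorems.BarrierLever.HiddenStates
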